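import Summits.BirchSwinnertonDyer.BirchSwinnertonDyer.Theorems.SchneiderFreeAdditiveX3KYBranchHalves
import HarnessLib

/-!
# Route `SchneiderFreeAdditiveX3` (K1 door): the hinge of Keller–Yin 2410.23241 Thm. 3.5.1 needs only the ONE-SIDED
# `λ`-inequality `λ(L₀) ≤ λ(𝔛)` — Thm. 3.5.1 (branch currency) ⟸ [DIV] ∧ [INV.μ] ∧ [INV.λ≤], and [INV] itself follows

Cell `bsd-schneider-ideate`, seat `bsd-schneider-door-c5` (prover, generation 24; assembly layer; `--supports` 19177).
PARTITION: board row B6 ∩ X3 ∩ sst-twist, `r = 1` (7 101 pairs; (G-ord, `e = 2`) half 2 560) — types-the-object-of nothing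
new; WEAKENS the `λ`-input of crux r3's one preprint claim to the inequality the kernel λ-count of this generation can feed;
closes none of B6's cells (BSD NOT advanced).  bears_on: K1-door (items 18971/18972 → 19177 r3 `GordTwoBranchIMC`).

## Why

Generation 22 proved Keller–Yin's "force the equality" step as `KYBranchHalves.thm351_charIdeal_eq_branch_OPEN_of_divisibility_of_invariants :
[DIV] → [INV] → KYb`, where [INV]'s `λ`-clause asks the branch frame's first unit coefficient to sit EXACTLY at `λ(𝔛)`.  But in
`R₀⟦T⟧`, once `p^k·L₀ ∈ (g)` with `μ(g) = 0` (so `g ∣ L₀`) and `μ(L₀) = 0`, Gauss's lemma gives `λ(L₀) = λ(g) + λ(cofactor) ≥ λ(g)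
= λ(𝔛)` for free: only the inequality `λ(L₀) ≤ λ(𝔛)` carries information.  This file proves the hinge from that inequality and
re-keys the glue: Thm. 3.5.1 (branch currency) ⟸ [DIV] `thm336_divisibility_branch_OPEN` ∧ [INV.μ] `thm351_muInvariant_eq_zero_OPEN`
∧ [INV.λ≤] (inline: every branch frame is `p^c·L₀` with a first unit coefficient at SOME `n ≤ λ(𝔛)`), and [INV] is then a
CONSEQUENCE.  Point: [INV.λ≤] is exactly what the Greenberg–Vatsal road delivers at `p ≥ 5` — the kernel λ-count of this
generation (`KYLambdaAlgChar.add_add_sum_le_lambdaInvariant_xAc_empty_add_sum_curveLocalLambda_…`: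
`λ(𝔛_{θsub}) + λ(𝔛_{θquot}) + ΣΣ λ𝒫_w(θ) ≤ λ(𝔛) + Σ λ𝒫_w(E_K)`, modulo published facts) bounds `λ(𝔛)` from BELOW, so an analytic
count `λ(L₀) + Σ λ𝒫_w(E_K) = λ(𝓛_{θsub}) + λ(𝓛_{θquot}) + ΣΣ λ𝒫_w(θ)` together with Rubin's `λ(𝓛_θ) = λ(𝔛_θ)` yields precisely
`λ(L₀) ≤ λ(𝔛)`; the reverse inequality of Greenberg–Vatsal Prop. 2.4 (Pollack–Weston surjectivity) is never needed by the door.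

## What

* §1 `span_singleton_eq_of_C_pow_mul_mem_of_le` — `R₀⟦T⟧` algebra: `p^k·L ∈ (F)`, first unit coefficients of `F` at `n` and of `L`
  at `m ≤ n` ⟹ `(F) = (L)` and `m = n` (X1's `exists_mul_eq_of_mul_eq_C_pow_mul` + `exists_firstUnitCoeffAt_right`).
* §2 `charIdeal_map_eq_span_of_C_pow_mul_mem_of_firstUnitCoeff_le` — the hinge for a finitely generated torsion `Λ`-module `X`
  with `μ(X) = 0` along any structure map `j`: `p^m·L₀ ∈ Ch_Λ(X)·R₀⟦T⟧`, `FirstUnitCoeffAt L₀ n`, `n ≤ λ(X)` ⟹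
  `Ch_Λ(X)·R₀⟦T⟧ = (L₀)` and `n = λ(X)`.
* §3 **`thm351_charIdeal_eq_branch_OPEN_of_divisibility_of_muZero_of_lambda_le`** : [DIV] → [INV.μ] → [INV.λ≤] → KYb, and
  **`thm351_invariants_branch_OPEN_of_divisibility_of_muZero_of_lambda_le`** : [DIV] → [INV.μ] → [INV.λ≤] → [INV]
  ([INV.λ≤] spelled out as the hypothesis `hlamle`; no new named fact).

HONEST FRAMING: §1–§2 unconditional algebra; §3 composition of tree theorems CONDITIONAL on the displayed hypotheses ([DIV],
[INV.μ] are `[claim …]` Props of an unrefereed preprint; `hlamle` is an explicit hypothesis, at present supplied by nothing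
in the tree — its analytic half is Keller–Yin §3.5's Eisenstein congruence, PREPRINT); no definition, no named fact, no
`sorry`; nothing about BSD or a main conjecture is asserted; «closes rung: none».
References: Keller–Yin arXiv:2410.23241 §3.5 [p0020:L1], Thm. 3.5.1 [KellerYin2024b]; Washington, *Cyclotomic Fields* §7.1 Prop. 7.2,
§13.2 [Washington1997]; Castella–Grossi–Lee–Skinner 2022 Thm. 3.2.1 [CastellaGrossiLeeSkinner2022]; Greenberg–Vatsal 2000 §2–§3
[GreenbergVatsal2000]; this seat p658601, p659788 (generation 22), `…KYLambdaAlgCharRelaxationOfPrintFiveLe` (generation 24).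
-/

set_option autoImplicit false
-- `Summit.<P>.<Sub>` repeats `BirchSwinnertonDyer` by the tree's layout convention (D-0017)
set_option linter.dupNamespace false

noncomputable section

open scoped Classical NumberField

open Field NumberField IsDedekindDomain WeierstrassCurve PowerSeries
  Literature.NumberTheory.EllipticCurves Literature.NumberTheory.EllipticCurves.GreenbergSelmer
  Literature.NumberTheory.GaloisRepresentations
  Literature.NumberTheory.EllipticCurves.ModularForms Literature.NumberTheory.EllipticCurves.Rank1Residual
  Literature.NumberTheory.EllipticCurves.KellerYin2024
  Summit.BirchSwinnertonDyer.Rank1Residual Summit.BirchSwinnertonDyer.Rank1Residual.X11b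
open Summit.BirchSwinnertonDyer.Rank1Residual.X1.KellerYinHalves
  (exists_mul_eq_of_mul_eq_C_pow_mul exists_firstUnitCoeffAt_right span_singleton_eq_of_firstUnitCoeffAt)

namespace Summit.BirchSwinnertonDyer.BirchSwinnertonDyer.Theorems.SchneiderFreeAdditiveX3.KYBranchHalves

variable {p : ℕ} [Fact p.Prime]

/-! ### §1 `R₀⟦T⟧`: one divisibility with slack + `μ = 0` on both sides + `λ(L) ≤ λ(F)` force `(F) = (L)` -/

/-- **One divisibility and a ONE-SIDED `λ`-inequality force the equality of ideals.**  In `R₀⟦T⟧`: if `p^k·L ∈ (F)`, `F` has its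
first unit coefficient at `n` and `L` at some `m ≤ n`, then `(F) = (L)` and `m = n`.  (Cancel `p^k` against the unit coefficient
of `F`: `L = F·G'`; Gauss's lemma puts the first unit coefficient of `F·G'` at `n + b`, so `m = n + b ≤ n` forces `b = 0`: `G'`
is a unit.)  The reverse inequality `n ≤ m` is automatic — this is why only `λ(𝓛) ≤ λ(𝔛)` carries content in "equal invariants
+ one divisibility ⟹ equality". [cite: Washington1997, §7.1 Prop. 7.2] -/
theorem span_singleton_eq_of_C_pow_mul_mem_of_le {F L : UnrSeries p} {k n m : ℕ}
    (hdiv : C ((p : unrIntegers p) ^ k) * L ∈ Ideal.span ({F} : Set (UnrSeries p)))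
    (hF : (‖((coeff n F : unrIntegers p) : ℂ_[p])‖ = 1 ∧
      ∀ i < n, ‖((coeff i F : unrIntegers p) : ℂ_[p])‖ < 1))
    (hL : (‖((coeff m L : unrIntegers p) : ℂ_[p])‖ = 1 ∧
      ∀ i < m, ‖((coeff i L : unrIntegers p) : ℂ_[p])‖ < 1))
    (hmn : m ≤ n) :
    Ideal.span ({F} : Set (UnrSeries p)) = Ideal.span {L} ∧ m = n := by
  obtain ⟨G, hG⟩ := Ideal.mem_span_singleton'.mp hdiv
  obtain ⟨G', hG'⟩ := exists_mul_eq_of_mul_eq_C_pow_mul hF (by rw [← hG, mul_comm])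
  have hFG : (‖((coeff m (F * G') : unrIntegers p) : ℂ_[p])‖ = 1 ∧
      ∀ i < m, ‖((coeff i (F * G') : unrIntegers p) : ℂ_[p])‖ < 1) := by rw [hG']; exact hL
  obtain ⟨b, -, hnb⟩ := exists_firstUnitCoeffAt_right hF hFG
  obtain rfl : m = n := by omega
  exact ⟨span_singleton_eq_of_firstUnitCoeffAt hF hL hG', rfl⟩

/-! ### §2 The hinge for a torsion `Λ`-module with `μ = 0`, from the one-sided inequality `n ≤ λ(X)` -/

/-- **"Force the equality" from ONE divisibility and the ONE-SIDED `λ`-inequality.**  Let `X` be a finitely generated torsion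
`Λ`-module with `μ(X) = 0`, `j : ℤ_p → R₀` a structure map, `L₀ ∈ R₀⟦T⟧` with a first unit coefficient at some `n ≤ λ(X)`.  If
`p^m · L₀ ∈ Ch_Λ(X)·R₀⟦T⟧` for some `m`, then `Ch_Λ(X)·R₀⟦T⟧ = (L₀)` AND `n = λ(X)`.  Generation 22's
`charIdeal_map_eq_span_of_C_pow_mul_mem_of_firstUnitCoeff` asked `n = λ(X)`; §1 shows the inequality suffices.
[cite: Washington1997, §7.1 Prop. 7.2 and §13.2] [cite: CastellaGrossiLeeSkinner2022, Thm. 3.2.1 (one divisibility + invariants)] -/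
theorem charIdeal_map_eq_span_of_C_pow_mul_mem_of_firstUnitCoeff_le (X : Type*) [AddCommGroup X]
    [Module (IwasawaAlgebra p) X] [Module.Finite (IwasawaAlgebra p) X]
    (hX : Module.IsTorsion (IwasawaAlgebra p) X) (hμ : muInvariant p X = 0)
    (j : ℤ_[p] →+* unrIntegers p)
    (hj : ∀ x : ℤ_[p], ((j x : unrIntegers p) : ℂ_[p]) = algebraMap ℚ_[p] ℂ_[p] (x : ℚ_[p]))
    {L₀ : UnrSeries p} {m n : ℕ} (hL₀ : FirstUnitCoeffAt L₀ n) (hn : n ≤ lambdaInvariant p X)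
    (hmem : C ((p : unrIntegers p) ^ m) * L₀ ∈ (Module.charIdeal (IwasawaAlgebra p) X).map (PowerSeries.map j)) :
    (Module.charIdeal (IwasawaAlgebra p) X).map (PowerSeries.map j) = Ideal.span {L₀} ∧ n = lambdaInvariant p X := by
  obtain ⟨g, hg⟩ := exists_charIdeal_eq_span (p := p) X
  have hmap : (Module.charIdeal (IwasawaAlgebra p) X).map (PowerSeries.map j) = Ideal.span {PowerSeries.map j g} := by
    rw [hg, Ideal.map_span, Set.image_singleton]
  rw [hmap] at hmem ⊢
  exact span_singleton_eq_of_C_pow_mul_mem_of_le hmem (firstUnitCoeff_map_of_charIdeal_eq_span X hX hμ hg j hj) hL₀ hn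

/-! ### §3 Keller–Yin Thm. 3.5.1 (branch currency) from [DIV] ∧ [INV.μ] ∧ the one-sided `λ`-clause; [INV] as a consequence -/

/-- **Keller–Yin Thm. 3.5.1 in branch currency ⟸ [DIV] ∧ [INV.μ] ∧ [INV.λ≤].**  Hypotheses BY NAME: [DIV]
`thm336_divisibility_branch_OPEN` (Thm. 3.3.6 ∘ Prop. 3.4.4), [INV.μ] `thm351_muInvariant_eq_zero_OPEN` ("`μ(𝔛) = 0`"), and the
ONE-SIDED `λ`-clause `hlamle`: over the branch binders, every branch frame is `L = p^c·L₀` with a first unit coefficient of `L₀` at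
SOME index `n ≤ λ(𝔛)` (i.e. "`μ(𝓛_ε) = 0` and `λ(𝓛_ε) ≤ λ(𝔛)`" up to the slack).  Conclusion: `thm351_charIdeal_eq_branch_OPEN`.
At each frame: [DIV] gives `p^{k+c}·L₀ ∈ Ch_Λ(𝔛)·R₀⟦T⟧`, `X_ac^∅` is finitely generated unconditionally, and §2 gives both the
equality of ideals and `n = λ(𝔛)`.  Compared with generation 22's `…_of_divisibility_of_invariants`, the `λ`-EQUALITY of [INV] is no
longer an input.  CONDITIONAL on the displayed hypotheses; the deduction is unconditional; nothing asserted about any curve.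
[cite: KellerYin2024b, §3.5 first paragraph and Thm. 3.5.1 (arXiv:2410.23241 p. 20) (preprint; the deduction transcribed and sharpened)]
[cite: Washington1997, §7.1 Prop. 7.2 and §13.2] [cite: CastellaGrossiLeeSkinner2022, Thm. 3.2.1] -/
theorem thm351_charIdeal_eq_branch_OPEN_of_divisibility_of_muZero_of_lambda_le
    (hDIV : thm336_divisibility_branch_OPEN) (hμ0 : thm351_muInvariant_eq_zero_OPEN)
    (hlamle : ∀ {p : ℕ} [Fact p.Prime] (ι' : PadicAlgCl p ≃+* ℂ) (W : WeierstrassCurve ℚ) [W.IsElliptic]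
      [W.IsGloballyMinimal] (K : Type) [Field K] [NumberField K] [IsGalois ℚ K]
      (v vbar : HeightOneSpectrum (𝓞 K)) (κ : ZpExtension K p) (γ : absoluteGaloisGroup K)
      [Fact (κ.IsTopGenerator γ)] {N : ℕ} [NeZero N] {f : CuspForm (CongruenceSubgroup.Gamma0 N) 2}
      (_ : IsNewformOf W f), PotOrdSetting ι' W K v vbar κ N →
      ∀ {N' : ℕ} [NeZero N'] {f' : CuspForm (CongruenceSubgroup.Gamma0 N') 2}, IsNewform0 f' →
        ¬ p ∣ N' →
        (∃ S : Finset ℕ, ∀ ℓ : ℕ, ℓ.Prime → ℓ ∉ S →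
          cuspCoeff f ℓ = ((legendreSym p ℓ : ℤ) : ℂ) * cuspCoeff f' ℓ) →
      ∀ (e : ℂ) (ΩK : ℂ) (Ωp : ℂ_[p]) (L : UnrSeries p), e ≠ 0 → ΩK ≠ 0 → Ωp ≠ 0 →
        IsBranchBDPLFunction ι' v κ γ f' (KellerYin2024.genusHeckeCharacter K p) e ΩK Ωp L →
        ∃ (c : ℕ) (L₀ : UnrSeries p) (n : ℕ), L = C ((p : unrIntegers p) ^ c) * L₀ ∧ FirstUnitCoeffAt L₀ n ∧
          n ≤ lambdaInvariant p (Literature.NumberTheory.EllipticCurves.Castella2018.AcSelmer.XAc (W.baseChange K) p κ vbar ∅ γ)) :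
    thm351_charIdeal_eq_branch_OPEN := by
  intro p _ ι' W _ _ K _ _ _ v vbar κ γ _ N _ f hf hS N' _ f' hf' hpN' htw e ΩK Ωp L he hΩK hΩp hL j hj
  obtain ⟨hT, hdiv⟩ := hDIV ι' W K v vbar κ γ hf hS hf' hpN' htw
  have hμ := hμ0 ι' W K v vbar κ γ hf hS
  obtain ⟨c, L₀, n, hLL₀, hfu, hn⟩ := hlamle ι' W K v vbar κ γ hf hS hf' hpN' htw e ΩK Ωp L he hΩK hΩp hL
  obtain ⟨k, hk⟩ := hdiv e ΩK Ωp L he hΩK hΩp hL j hj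
  haveI : Module.Finite (IwasawaAlgebra p)
      (Literature.NumberTheory.EllipticCurves.Castella2018.AcSelmer.XAc (W.baseChange K) p κ vbar ∅ γ) :=
    Literature.NumberTheory.EllipticCurves.Castella2018.AcSelmer.XAc.module_finite_empty _ p κ vbar γ
  have hk' : C ((p : unrIntegers p) ^ (k + c)) * L₀ ∈
      (Literature.NumberTheory.EllipticCurves.Module.charIdeal (IwasawaAlgebra p)
        (Literature.NumberTheory.EllipticCurves.Castella2018.AcSelmer.XAc (W.baseChange K) p κ vbar ∅ γ)).map
        (PowerSeries.map j) := by
    rw [pow_add, map_mul, mul_assoc, ← hLL₀]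
    exact hk
  obtain ⟨heq, rfl⟩ := charIdeal_map_eq_span_of_C_pow_mul_mem_of_firstUnitCoeff_le _ hT hμ j hj hfu hn hk'
  exact ⟨c, L₀, hLL₀, hfu, heq⟩

/-- **[INV] is a CONSEQUENCE of [DIV] ∧ [INV.μ] ∧ [INV.λ≤]**: under the same three hypotheses, Keller–Yin's full first sentence
of Thm. 3.5.1 in branch currency (`thm351_invariants_branch_OPEN`: "`μ(𝔛) = 0` and the frame's first unit coefficient sits AT
`λ(𝔛)`") holds — the `λ`-EQUALITY is forced (§2's second conjunct), it need not be assumed.  A structure map `j` exists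
(`X11b.Halves.toUnr`), which is all the `λ`-identity needs from [DIV].
[cite: KellerYin2024b, Thm. 3.5.1 first sentence (arXiv:2410.23241 p. 20) (preprint; derived from its one-sided half)]
[cite: Washington1997, §7.1 Prop. 7.2] -/
theorem thm351_invariants_branch_OPEN_of_divisibility_of_muZero_of_lambda_le
    (hDIV : thm336_divisibility_branch_OPEN) (hμ0 : thm351_muInvariant_eq_zero_OPEN)
    (hlamle : ∀ {p : ℕ} [Fact p.Prime] (ι' : PadicAlgCl p ≃+* ℂ) (W : WeierstrassCurve ℚ) [W.IsElliptic]
      [W.IsGloballyMinimal] (K : Type) [Field K] [NumberField K] [IsGalois ℚ K]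
      (v vbar : HeightOneSpectrum (𝓞 K)) (κ : ZpExtension K p) (γ : absoluteGaloisGroup K)
      [Fact (κ.IsTopGenerator γ)] {N : ℕ} [NeZero N] {f : CuspForm (CongruenceSubgroup.Gamma0 N) 2}
      (_ : IsNewformOf W f), PotOrdSetting ι' W K v vbar κ N →
      ∀ {N' : ℕ} [NeZero N'] {f' : CuspForm (CongruenceSubgroup.Gamma0 N') 2}, IsNewform0 f' →
        ¬ p ∣ N' →
        (∃ S : Finset ℕ, ∀ ℓ : ℕ, ℓ.Prime → ℓ ∉ S →
          cuspCoeff f ℓ = ((legendreSym p ℓ : ℤ) : ℂ) * cuspCoeff f' ℓ) →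
      ∀ (e : ℂ) (ΩK : ℂ) (Ωp : ℂ_[p]) (L : UnrSeries p), e ≠ 0 → ΩK ≠ 0 → Ωp ≠ 0 →
        IsBranchBDPLFunction ι' v κ γ f' (KellerYin2024.genusHeckeCharacter K p) e ΩK Ωp L →
        ∃ (c : ℕ) (L₀ : UnrSeries p) (n : ℕ), L = C ((p : unrIntegers p) ^ c) * L₀ ∧ FirstUnitCoeffAt L₀ n ∧
          n ≤ lambdaInvariant p (Literature.NumberTheory.EllipticCurves.Castella2018.AcSelmer.XAc (W.baseChange K) p κ vbar ∅ γ)) :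
    thm351_invariants_branch_OPEN := by
  have hKYb : thm351_charIdeal_eq_branch_OPEN :=
    thm351_charIdeal_eq_branch_OPEN_of_divisibility_of_muZero_of_lambda_le hDIV hμ0 @hlamle
  intro p _ ι' W _ _ K _ _ _ v vbar κ γ _ N _ f hf hS N' _ f' hf' hpN' htw
  refine ⟨hμ0 ι' W K v vbar κ γ hf hS, fun e ΩK Ωp L he hΩK hΩp hL ↦ ?_⟩
  exact firstUnitCoeff_of_thm351_branch_OPEN hKYb ι' W K v vbar κ γ hf hS hf' hpN' htw he hΩK hΩp hL
    (X11b.Halves.toUnr p) (X11b.Halves.coe_toUnr p)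

end Summit.BirchSwinnertonDyer.BirchSwinnertonDyer.Theorems.SchneiderFreeAdditiveX3.KYBranchHalves

end
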